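import Mathlib

/-!
# PercRepro — the seven-point shape (i): the σ-DECOMPOSITION of a loss and the request arithmetic (night-2, gen 30)

A seven-point one-coloop target `S ∖ K = {w} ∪ ℓ₁ ∪ ℓ₂` (two disjoint collinear triples spanning the hyperplane `H` at the
coloop `w`) has six potential sources, the points of the two lines; a source `y ∈ ℓ₁` with `ℓ₁ ∖ y = {a, b}` has the three
faces with closures `H`, `K_a = cl(K ∪ w ∪ ℓ₂ ∪ a)`, `K_b` (proofs/NIGHT-2-g30.md §1).  The request of a thin member whose
closure misses `m` points is `ρ(m) = (7/6)/(m + 2)` (`rhoReq`); a face with `s` outside points off it has `m = 2 + s`.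
In the H-FAT regime (`r_H = 7/24`, capacity `23/72`) a loss `(7/24 + r_a + r_b − 11/18)⁺` is at most `sigHF s_a + sigHF s_b`
with `sigHF 1 = 53/720`, `sigHF 2 = 25/720`, `sigHF 3 = 5/720`, `sigHF s = 0` for `s ≥ 4` (`lossHF_le_sigHF_add`), and it
vanishes when one of its faces is NULL (`s = 0`: request `0`, the other at most `7/30`).  This file: `rhoReq`, `sigHF`, the
σ-decomposition, the division helpers and the small sums `φ`, `ψ`, `ψ′`, `χ`, `ω` of the per-side bounds
(Night2ShapeOneSideA … D).
-/

namespace PercRepro.Shadow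

/-- The request of a thin member whose closure misses `m` points of `G` (with `|E ∖ G| = 2`): `(7/6)/(m + 2)`. -/
def rhoReq (m : ℕ) : ℚ := (7 / 6) / ((m : ℚ) + 2)

/-- `ρ(m) ≥ 0`. -/
theorem rhoReq_nonneg (m : ℕ) : 0 ≤ rhoReq m := by
  unfold rhoReq; positivity

/-- `ρ(2) = 7/24`. -/
theorem rhoReq_two : rhoReq 2 = 7 / 24 := by unfold rhoReq; norm_num
/-- `ρ(3) = 7/30`. -/
theorem rhoReq_three : rhoReq 3 = 7 / 30 := by unfold rhoReq; norm_num
/-- `ρ(4) = 7/36`. -/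
theorem rhoReq_four : rhoReq 4 = 7 / 36 := by unfold rhoReq; norm_num
/-- `ρ(5) = 1/6`. -/
theorem rhoReq_five : rhoReq 5 = 1 / 6 := by unfold rhoReq; norm_num
/-- `ρ(6) = 7/48`. -/
theorem rhoReq_six : rhoReq 6 = 7 / 48 := by unfold rhoReq; norm_num

/-- `ρ` is antitone. -/
theorem rhoReq_anti {m m' : ℕ} (h : m ≤ m') : rhoReq m' ≤ rhoReq m := by
  unfold rhoReq
  have h' : (m : ℚ) ≤ (m' : ℚ) := by exact_mod_cast h
  exact div_le_div_of_nonneg_left (by norm_num) (by positivity) (by linarith)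

/-- For `m ≥ 3` the request is at most `7/30`. -/
theorem rhoReq_le_thin {m : ℕ} (h : 3 ≤ m) : rhoReq m ≤ 7 / 30 := by
  rw [← rhoReq_three]; exact rhoReq_anti h

/-- For `m ≥ 6` the request is at most `7/48`. -/
theorem rhoReq_le_six {m : ℕ} (h : 6 ≤ m) : rhoReq m ≤ 7 / 48 := by
  rw [← rhoReq_six]; exact rhoReq_anti h

/-- The H-fat σ-value of a face with `s` visible points off it: `(ρ(2 + s) − 23/144)⁺`. -/
def sigHF (s : ℕ) : ℚ := if s = 1 then 53 / 720 else if s = 2 then 25 / 720 else if s = 3 then 5 / 720 else 0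

/-- `sigHF s ≥ 0`. -/
theorem sigHF_nonneg (s : ℕ) : 0 ≤ sigHF s := by
  unfold sigHF; split_ifs <;> norm_num

/-- `sigHF 0 = 0`. -/
theorem sigHF_zero : sigHF 0 = 0 := by unfold sigHF; norm_num
/-- `sigHF 1 = 53/720`. -/
theorem sigHF_one : sigHF 1 = 53 / 720 := by unfold sigHF; norm_num
/-- `sigHF 2 = 25/720`. -/
theorem sigHF_two : sigHF 2 = 25 / 720 := by unfold sigHF; norm_num
/-- `sigHF 3 = 5/720`. -/
theorem sigHF_three : sigHF 3 = 5 / 720 := by unfold sigHF; norm_num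
/-- `sigHF s = 0` for `s ≥ 4`. -/
theorem sigHF_of_four_le {s : ℕ} (h : 4 ≤ s) : sigHF s = 0 := by
  unfold sigHF
  rw [if_neg (by omega), if_neg (by omega), if_neg (by omega)]

/-- `sigHF s ≤ 53/720` always. -/
theorem sigHF_le_one (s : ℕ) : sigHF s ≤ 53 / 720 := by
  unfold sigHF; split_ifs <;> norm_num

/-- `sigHF s ≤ 25/720` for `s ≥ 2`. -/
theorem sigHF_le_two {s : ℕ} (h : 2 ≤ s) : sigHF s ≤ 25 / 720 := by
  unfold sigHF; rw [if_neg (by omega)]; split_ifs <;> norm_num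

/-- `sigHF s ≤ 5/720` for `s ≥ 3`. -/
theorem sigHF_le_three {s : ℕ} (h : 3 ≤ s) : sigHF s ≤ 5 / 720 := by
  unfold sigHF; rw [if_neg (by omega), if_neg (by omega)]; split_ifs <;> norm_num

/-- An admissible request `r ≤ ρ(2 + s)` (and `r = 0` at a null face) satisfies `r − 23/144 ≤ sigHF s`. -/
theorem sub_le_sigHF {s : ℕ} {r : ℚ} (hr : r ≤ rhoReq (2 + s)) (h0 : s = 0 → r = 0) :
    r - 23 / 144 ≤ sigHF s := by
  rcases Nat.lt_or_ge s 4 with hlt | hge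
  · interval_cases s
    · rw [h0 rfl, sigHF_zero]; norm_num
    · rw [sigHF_one]; rw [show 2 + 1 = 3 from rfl, rhoReq_three] at hr; linarith
    · rw [sigHF_two]; rw [show 2 + 2 = 4 from rfl, rhoReq_four] at hr; linarith
    · rw [sigHF_three]; rw [show 2 + 3 = 5 from rfl, rhoReq_five] at hr; linarith
  · rw [sigHF_of_four_le hge]
    have := rhoReq_le_six (m := 2 + s) (by omega)
    linarith

/-- **The σ-decomposition of a loss in the H-fat regime**: with `r_H = 7/24` the loss of a source with faces `a`, `b` is at
most `sigHF s_a + sigHF s_b`. -/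
theorem lossHF_le_sigHF_add {sa sb : ℕ} {ra rb : ℚ} (hra : ra ≤ rhoReq (2 + sa)) (ha0 : sa = 0 → ra = 0)
    (hrb : rb ≤ rhoReq (2 + sb)) (hb0 : sb = 0 → rb = 0) :
    max (7 / 24 + ra + rb - 11 / 18) 0 ≤ sigHF sa + sigHF sb := by
  have h1 := sub_le_sigHF hra ha0
  have h2 := sub_le_sigHF hrb hb0
  have h3 := sigHF_nonneg sa
  have h4 := sigHF_nonneg sb
  apply max_le
  · linarith
  · linarith

/-- A loss vanishes when one of its faces is null (`s = 0`, request `0`) and the other requests at most `7/30`. -/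
theorem lossHF_eq_zero_of_null {ra rb : ℚ} (ha : ra = 0) (hb : rb ≤ 7 / 30) :
    max (7 / 24 + ra + rb - 11 / 18) 0 = 0 := by
  rw [ha]
  apply max_eq_right
  linarith

/-- An admissible request is at most `7/30` or vanishes (at a null face). -/
theorem req_le_thin_of_adm {s : ℕ} {r : ℚ} (hr : r ≤ rhoReq (2 + s)) (h0 : s = 0 → r = 0) : r ≤ 7 / 30 := by
  rcases Nat.eq_zero_or_pos s with h | h
  · rw [h0 h]; norm_num
  · exact hr.trans (rhoReq_le_thin (by omega))

/-- A loss vanishes when its FIRST face is null. -/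
theorem lossHF_eq_zero_of_null_left {sb : ℕ} {ra rb : ℚ} (ha : ra = 0) (hrb : rb ≤ rhoReq (2 + sb))
    (hb0 : sb = 0 → rb = 0) : max (7 / 24 + ra + rb - 11 / 18) 0 = 0 :=
  lossHF_eq_zero_of_null ha (req_le_thin_of_adm hrb hb0)

/-- A loss vanishes when its SECOND face is null. -/
theorem lossHF_eq_zero_of_null_right {sa : ℕ} {ra rb : ℚ} (hb : rb = 0) (hra : ra ≤ rhoReq (2 + sa))
    (ha0 : sa = 0 → ra = 0) : max (7 / 24 + ra + rb - 11 / 18) 0 = 0 := by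
  rw [hb]
  apply max_eq_right
  have := req_le_thin_of_adm hra ha0
  linarith

/-! ## Division helpers -/

/-- `0 ≤ a ≤ A` and `g ≥ k ≥ 1` give `a / g ≤ A / k`. -/
theorem div_nat_le_div_of_le {a A : ℚ} (ha : 0 ≤ a) (haA : a ≤ A) {g k : ℕ} (hk : 1 ≤ k) (hg : k ≤ g) :
    a / (g : ℚ) ≤ A / (k : ℚ) := by
  have hk' : (1 : ℚ) ≤ (k : ℚ) := by exact_mod_cast hk
  have hg' : (k : ℚ) ≤ (g : ℚ) := by exact_mod_cast hg
  calc a / (g : ℚ) ≤ a / (k : ℚ) := div_le_div_of_nonneg_left ha (by linarith) hg'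
    _ ≤ A / (k : ℚ) := div_le_div_of_nonneg_right haA (by linarith)

/-- A vanishing numerator. -/
theorem zero_div_nat (g : ℕ) : (0 : ℚ) / (g : ℚ) = 0 := zero_div _


/-! ## The three-term helpers (units of `1/720`) -/

/-- Three nonnegative terms each at most `A / k` with `k ≥ 1`. -/
theorem three_terms_le {t₁ t₂ t₃ A : ℚ} (h₁ : t₁ ≤ A) (h₂ : t₂ ≤ A) (h₃ : t₃ ≤ A) : t₁ + t₂ + t₃ ≤ 3 * A := by
  linarith

/-- `2 · sigHF n / (1 + n) ≤ 53/720` for every `n`: the null-face load. -/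
theorem two_sigHF_div_le (n : ℕ) : 2 * sigHF n / ((1 + n : ℕ) : ℚ) ≤ 53 / 720 := by
  rcases Nat.lt_or_ge n 4 with hlt | hge
  · interval_cases n
    · rw [sigHF_zero]; norm_num
    · rw [sigHF_one]; norm_num
    · rw [sigHF_two]; norm_num
    · rw [sigHF_three]; norm_num
  · rw [sigHF_of_four_le hge]; norm_num

/-- `φ(n) = sigHF n + (25/720 + sigHF n) / (1 + n) ≤ 92/720` for every `n ≥ 1`: the one-null-face load per active face. -/
theorem phiHF_le (n : ℕ) (hn : 1 ≤ n) : sigHF n + (25 / 720 + sigHF n) / ((1 + n : ℕ) : ℚ) ≤ 92 / 720 := by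
  rcases Nat.lt_or_ge n 4 with hlt | hge
  · interval_cases n
    · rw [sigHF_one]; norm_num
    · rw [sigHF_two]; norm_num
    · rw [sigHF_three]; norm_num
  · rw [sigHF_of_four_le hge]
    have h4 : (5 : ℚ) ≤ ((1 + n : ℕ) : ℚ) := by exact_mod_cast (by omega : 5 ≤ 1 + n)
    have : (25 / 720 + 0) / ((1 + n : ℕ) : ℚ) ≤ (25 / 720 + 0) / 5 :=
      div_le_div_of_nonneg_left (by norm_num) (by norm_num) h4
    linarith

/-- `ψ(n) = sigHF n / 2 + (25/720 + sigHF n)/(1 + n) ≤ 131/1440` (`= 65.5/720`) for `n ≥ 1`. -/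
theorem psiHF_le (n : ℕ) (hn : 1 ≤ n) : sigHF n / 2 + (25 / 720 + sigHF n) / ((1 + n : ℕ) : ℚ) ≤ 131 / 1440 := by
  rcases Nat.lt_or_ge n 4 with hlt | hge
  · interval_cases n
    · rw [sigHF_one]; norm_num
    · rw [sigHF_two]; norm_num
    · rw [sigHF_three]; norm_num
  · rw [sigHF_of_four_le hge]
    have h4 : (5 : ℚ) ≤ ((1 + n : ℕ) : ℚ) := by exact_mod_cast (by omega : 5 ≤ 1 + n)
    have : (25 / 720 + 0) / ((1 + n : ℕ) : ℚ) ≤ (25 / 720 + 0) / 5 :=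
      div_le_div_of_nonneg_left (by norm_num) (by norm_num) h4
    linarith

/-- `ψ′(n) = sigHF n / 2 + (25/720 + sigHF n)/(2 + n) ≤ 105/1440` (`= 52.5/720`) for `n ≥ 1`. -/
theorem psiHF'_le (n : ℕ) (hn : 1 ≤ n) : sigHF n / 2 + (25 / 720 + sigHF n) / ((2 + n : ℕ) : ℚ) ≤ 105 / 1440 := by
  rcases Nat.lt_or_ge n 4 with hlt | hge
  · interval_cases n
    · rw [sigHF_one]; norm_num
    · rw [sigHF_two]; norm_num
    · rw [sigHF_three]; norm_num
  · rw [sigHF_of_four_le hge]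
    have h4 : (6 : ℚ) ≤ ((2 + n : ℕ) : ℚ) := by exact_mod_cast (by omega : 6 ≤ 2 + n)
    have : (25 / 720 + 0) / ((2 + n : ℕ) : ℚ) ≤ (25 / 720 + 0) / 6 :=
      div_le_div_of_nonneg_left (by norm_num) (by norm_num) h4
    linarith

/-- The three properties of a loss used by the per-side bounds: nonnegative, σ-bounded, vanishing at a null face. -/
theorem lossHF_props {sa sb : ℕ} {ra rb : ℚ} (hra : ra ≤ rhoReq (2 + sa)) (ha0 : sa = 0 → ra = 0)
    (hrb : rb ≤ rhoReq (2 + sb)) (hb0 : sb = 0 → rb = 0) :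
    0 ≤ max (7 / 24 + ra + rb - 11 / 18) 0 ∧ max (7 / 24 + ra + rb - 11 / 18) 0 ≤ sigHF sa + sigHF sb ∧
      (sa = 0 ∨ sb = 0 → max (7 / 24 + ra + rb - 11 / 18) 0 = 0) := by
  refine ⟨le_max_right _ _, lossHF_le_sigHF_add hra ha0 hrb hb0, ?_⟩
  rintro (h | h)
  · exact lossHF_eq_zero_of_null_left (ha0 h) hrb hb0
  · exact lossHF_eq_zero_of_null_right (hb0 h) hra ha0

/-- `χ(n) = sigHF n / 2 + sigHF n / (1 + n)`: `χ(n_c) + χ(n_d) ≤ 57/720` when `n_c + n_d ≥ 4`, `n_c, n_d ≥ 1`. -/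
theorem chiHF_sum_le (nc nd : ℕ) (hc : 1 ≤ nc) (hd : 1 ≤ nd) (h : 4 ≤ nc + nd) :
    sigHF nc / 2 + sigHF nc / ((1 + nc : ℕ) : ℚ) + (sigHF nd / 2 + sigHF nd / ((1 + nd : ℕ) : ℚ)) ≤ 57 / 720 := by
  have chi : ∀ n : ℕ, 1 ≤ n → sigHF n / 2 + sigHF n / ((1 + n : ℕ) : ℚ) ≤ 53 / 720 ∧
      (2 ≤ n → sigHF n / 2 + sigHF n / ((1 + n : ℕ) : ℚ) ≤ 21 / 720) ∧
      (3 ≤ n → sigHF n / 2 + sigHF n / ((1 + n : ℕ) : ℚ) ≤ 4 / 720) := by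
    intro n hn
    rcases Nat.lt_or_ge n 4 with hlt | hge
    · interval_cases n
      · rw [sigHF_one]; norm_num
      · rw [sigHF_two]; norm_num
      · rw [sigHF_three]; norm_num
    · rw [sigHF_of_four_le hge]; norm_num
  obtain ⟨c1, c2, c3⟩ := chi nc hc
  obtain ⟨d1, d2, d3⟩ := chi nd hd
  rcases Nat.lt_or_ge nc 2 with h1 | h1
  · have := d3 (by omega); linarith
  · rcases Nat.lt_or_ge nd 2 with h2 | h2
    · have := c3 (by omega); linarith
    · have := c2 h1; have := d2 h2; linarith

/-- `ω`-sum: `sigHF a + sigHF b + (5/720 + sigHF a)/(1 + a) + (5/720 + sigHF b)/(1 + b) ≤ 117/720` when `a + b ≥ 3`,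
`a, b ≥ 1`. -/
theorem omegaHF_sum_le (a b : ℕ) (ha : 1 ≤ a) (hb : 1 ≤ b) (h : 3 ≤ a + b) :
    sigHF a + sigHF b + (5 / 720 + sigHF a) / ((1 + a : ℕ) : ℚ) + (5 / 720 + sigHF b) / ((1 + b : ℕ) : ℚ) ≤ 117 / 720 := by
  have om : ∀ n : ℕ, 1 ≤ n → sigHF n + (5 / 720 + sigHF n) / ((1 + n : ℕ) : ℚ) ≤ 82 / 720 ∧
      (2 ≤ n → sigHF n + (5 / 720 + sigHF n) / ((1 + n : ℕ) : ℚ) ≤ 35 / 720) := by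
    intro n hn
    rcases Nat.lt_or_ge n 4 with hlt | hge
    · interval_cases n
      · rw [sigHF_one]; norm_num
      · rw [sigHF_two]; norm_num
      · rw [sigHF_three]; norm_num
    · rw [sigHF_of_four_le hge]
      have h4 : (5 : ℚ) ≤ ((1 + n : ℕ) : ℚ) := by exact_mod_cast (by omega : 5 ≤ 1 + n)
      have : (5 / 720 + 0) / ((1 + n : ℕ) : ℚ) ≤ (5 / 720 + 0) / 5 :=
        div_le_div_of_nonneg_left (by norm_num) (by norm_num) h4
      constructor <;> intros <;> linarith
  obtain ⟨a1, a2⟩ := om a ha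
  obtain ⟨b1, b2⟩ := om b hb
  rcases Nat.lt_or_ge a 2 with h1 | h1
  · have := b2 (by omega); linarith
  · have := a2 h1; linarith

end PercRepro.Shadow
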